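import Mathlib.Topology.MetricSpace.HausdorffDistance
import Mathlib.Topology.MetricSpace.Isometry
import Mathlib.Analysis.Normed.MulAction
import Mathlib.Analysis.InnerProductSpace.PiL2
import Mathlib.Combinatorics.SimpleGraph.Maps
import Mathlib.Data.Set.Card
import Mathlib.Algebra.BigOperators.Finprod
import Mathlib.Data.Real.Pointwise
import HarnessLib

/-!
# The scale-free bond graph of a point configuration, ring numbers of bonds, and charge-free sites

Topic `Literature/Geometry/DiscreteGeometry`; definition request `defn-IsChargeFree` (route
`AtomisticToContinuum/Crystallization/LinkCensus`, items `stmt-AtomisticToContinuum-3509 … 3514`,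
where the notions below are inlined as `let`s).  Companion of `FejesTothKissingTwelve.lean`
(`contactGraph S`, exact contacts of a kissing configuration), `Fan.lean` (`plusGraph`) and of
Hales's link combinatorics (`KissingNodeDegree.lean`, `TameContactGraphs.lean`), but for the SOFT
bonds of an arbitrary configuration `y : ι → X` in a (pseudo)metric space, at every site's OWN
scale.

## The notions (all `[folklore]`: natural soft/scale-free variants of the cited definitions; the
precise form is the one the route inlines, see `isChargeFree_iff_route`)

* `nearestDist y j = ⨅ k ≠ j, dist (y j) (y k)` — the own nearest-neighbour distance `nn_j` of the
  site `j` (junk value `0` when `j` is the only site: `Real.iInf_of_isEmpty`).  It is Mathlib's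
  `Metric.infDist (y j) (y '' {k | k ≠ j})` (`nearestDist_eq_infDist`); the `iInf` form is kept
  because it is the form inlined in the route.
* `bondGraph η y : SimpleGraph ι` — the SCALE-FREE BOND GRAPH at tolerance `η`:
  `j ∼ k ↔ j ≠ k ∧ dist (y j) (y k) ≤ (1 + η) · min (nn_j) (nn_k)`.  Compare the bond graphs
  with an absolute bond range: Flatley–Theil's edge set
  `S = {(x, x') : | |y(x') − y(x)| − 1 | ≤ α}` [FlatleyTheil2015, (2.5), p. 5] and their contact
  graph `CG(Z)` (edges `|z₁ − z₂| = 1`, Definition 3.2), and De Luca–Friesecke's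
  `E = {{x, y} : α ≤ |x − y| ≤ β}` [LucaFriesecke2016, §2.2, (2.1)].  Here the range is read off
  the configuration itself, so that the graph is invariant under similarities
  (`bondGraph_comp_eq_of_dist_eq`, `bondGraph_smul`) and bonded sites automatically have scales
  within a factor `1 + η` of each other (`nearestDist_le_mul_of_adj`).
* `ringNumber η y i j = #(N(i) ∩ N(j))` — the number of common bond-neighbours of `i` and `j`
  (Mathlib's `SimpleGraph.commonNeighbors`, counted with `Set.ncard`); for a bond `{i, j}` this is
  the size of the ring of cells around it — the second index of the Honeycutt–Andersen pair
  classification ("1421/1422" for fcc/hcp bonds, "1551" for icosahedral ones) and the quantity of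
  Flatley–Theil's Conjecture 2.2: "If `z, z′` have the properties `#N(z) = #N(z′) = 12` and
  `z ∈ N(z′)`, then `#(N(z) ∩ N(z′)) ≥ 4`" [FlatleyTheil2015, Conjecture 2.2, p. 7].
* `IsChargeFree η y i` — the site `i` has exactly `12` bonds and every bond at `i` has ring number
  exactly `4`; equivalently the link of `i` is a `4`-regular graph on `12` vertices, as are the
  cuboctahedron (fcc) and the anticuboctahedron (hcp).  This is the scale-free, ring-number form
  of Flatley–Theil's REGULAR POINTS, Definition 3.6: "`X₁₂ = {x ∈ X : #N(x) = 12}`,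
  `X_reg = {x ∈ X₁₂ : ½ #A(x) = 24}`" (`A(x)` = the bonds inside `N(x)`; since
  `Σ_{j ∈ N(i)} ringNumber i j = #A(i)` counts ordered link edges, a charge-free site has
  `½ #A = 24`, and conversely `½ #A = 24` only fixes the AVERAGE ring number `4` — the equality
  `= 4` bond by bond is their Conjecture 2.2 built into the definition, as the route requests).
* `linkCharge η y i = |#N(i) − 12| + Σ_{j ∈ N(i)} |ringNumber i j − 4| ∈ ℕ` — the integer
  defect charge of the route (`linkCharge_eq_zero_iff : linkCharge η y i = 0 ↔ IsChargeFree η y i`);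
  Nelson's disclination charge uses the icosahedral reference ring number `5` instead of `4`
  [Nelson1983].

## API

* unfolding: `nearestDist_def`, `bondGraph_adj`, `mem_neighborSet_bondGraph`, `ringNumber_def`,
  `ringNumber_eq_ncard_commonNeighbors`, `ringNumber_comm`, `isChargeFree_iff`,
  **`isChargeFree_iff_route`** (the literal `let`-form inlined in the LinkCensus items, by
  `Iff.rfl`, so that those items can be restated over `IsChargeFree` by set-signature),
  `linkCharge_eq_zero_iff`;
* `nearestDist`: `nearestDist_nonneg`, `nearestDist_le_dist`, `le_nearestDist`,
  `nearestDist_eq_zero_of_subsingleton` (the junk value), `exists_nearestDist_eq_dist`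
  (attained among finitely many sites), `nearestDist_eq_infDist`;
* bonds: `dist_le_of_adj`, `nearestDist_le_mul_of_adj` (scales of bonded sites agree up to
  `1 + η`), `bondGraph_mono` (monotone in `η`), `IsChargeFree.finite_neighborSet`;
* invariance under similarities `g` (`dist (g p) (g q) = r · dist p q`, `r > 0`), isometries,
  scalings `c • y` (`c ≠ 0`) and re-indexing by an equivalence `e : κ ≃ ι`:
  `nearestDist_comp_eq_mul_of_dist_eq`, `bondGraph_comp_eq_of_dist_eq`,
  `isChargeFree_comp_iff_of_dist_eq`, `…_isometry`, `…_smul`, `nearestDist_comp_equiv`,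
  `bondGraph_comp_equiv`, `isChargeFree_comp_equiv_iff`.

## Design choices and junk values

* Everything is stated for `y : ι → X`, `X` a pseudo-metric space and `ι` any index type (the
  route: `ι = Fin N`, `X = EuclideanSpace ℝ (Fin 3)`); the constants `12` and `4` are those of
  close-packed `ℝ³` (in the plane one would use `6` and `2`).
* `nearestDist y j = 0` when `ι` has one element; coincident sites (`y` not injective) have scale
  `0` and are then bonded exactly to the sites they coincide with.  If a neighbour set is
  infinite its `Set.ncard` is `0`, so a site with infinitely many bonds is never charge-free and
  has `linkCharge = 12`.
* Not here: that interior sites of windows of close-packed Barlow stackings are charge-free for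
  `0 < η < √2 − 1`, and the soft link theorem (Flatley–Theil Proposition 3.3 / FTTT Theorem 3.5)
  — these are statements ABOUT the notion (route items `SoftFourRings`, `SoftLayerPropagation`).

## References

* L. C. Flatley, F. Theil, *Face-centered cubic crystallization of atomistic configurations*,
  Arch. Ration. Mech. Anal. 218 (2015) 363–416, arXiv:1407.0692: (2.5) (edge set `S`),
  Conjecture 2.2, Definition 3.2 (contact graph), Proposition 3.3, Definition 3.6 (regular
  points) (`FlatleyTheil2015`).
* L. Flatley, A. Tarasov, M. Taylor, F. Theil, *Packing twelve spherical caps to maximize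
  tangencies*, J. Comput. Appl. Math. 254 (2013) 220–225 (`FlatleyEtAl2013`): at most `24`
  contacts among twelve kissing balls, equality only for the two `4`-regular patterns.
* L. De Luca, G. Friesecke, *Crystallization in two dimensions and a discrete Gauss–Bonnet
  theorem*, J. Nonlinear Sci. 28 (2017), arXiv:1605.00034, §2.2 (bond graph), (3.4) (defect
  measure `μ`) (`LucaFriesecke2016`).
* J. D. Honeycutt, H. C. Andersen, J. Phys. Chem. 91 (1987) 4950–4963,
  doi:10.1021/j100303a014 (common-neighbour analysis) (`HoneycuttAndersen1987`).
* D. R. Nelson, Phys. Rev. B 28 (1983) 5515–5535, doi:10.1103/PhysRevB.28.5515 (disclination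
  charge from ring numbers) (`Nelson1983`).
-/

noncomputable section

namespace Literature.Geometry.DiscreteGeometry

open Set

variable {ι κ X X' : Type*} [PseudoMetricSpace X] [PseudoMetricSpace X']

/-! ### The own nearest-neighbour distance of a site -/

/-- The **own nearest-neighbour distance** `nn_j = inf_{k ≠ j} dist (y j) (y k)` of the site `j`
of a configuration `y : ι → X`, as an `iInf` over the other sites (junk value `0` when there is no
other site).  This is the local length scale at which the scale-free bond graph `bondGraph` reads
the bonds of `j`. [folklore] -/
def nearestDist (y : ι → X) (j : ι) : ℝ :=
  ⨅ k : {k : ι // k ≠ j}, dist (y j) (y k.1)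

/-- Unfolding `nearestDist`. [folklore] -/
theorem nearestDist_def (y : ι → X) (j : ι) :
    nearestDist y j = ⨅ k : {k : ι // k ≠ j}, dist (y j) (y k.1) := rfl

/-- `0 ≤ nn_j`. [folklore] -/
theorem nearestDist_nonneg (y : ι → X) (j : ι) : 0 ≤ nearestDist y j :=
  Real.iInf_nonneg fun _ => dist_nonneg

/-- `nn_j ≤ dist (y j) (y k)` for every other site `k`. [folklore] -/
theorem nearestDist_le_dist (y : ι → X) {j k : ι} (h : k ≠ j) :
    nearestDist y j ≤ dist (y j) (y k) :=
  ciInf_le ⟨0, by rintro _ ⟨k', rfl⟩; exact dist_nonneg⟩ (⟨k, h⟩ : {k : ι // k ≠ j})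

/-- A lower bound for all the other distances is a lower bound for `nn_j` (if there is another
site; otherwise `nn_j = 0`). [folklore] -/
theorem le_nearestDist {y : ι → X} {j : ι} {c : ℝ} (hj : ∃ k, k ≠ j)
    (H : ∀ k, k ≠ j → c ≤ dist (y j) (y k)) : c ≤ nearestDist y j := by
  obtain ⟨k, hk⟩ := hj
  haveI : Nonempty {k : ι // k ≠ j} := ⟨⟨k, hk⟩⟩
  exact le_ciInf fun k => H k.1 k.2

/-- The junk value: with a single site, `nn_j = 0`. [folklore] -/
theorem nearestDist_eq_zero_of_subsingleton [Subsingleton ι] (y : ι → X) (j : ι) :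
    nearestDist y j = 0 := by
  haveI : IsEmpty {k : ι // k ≠ j} := ⟨fun k => k.2 (Subsingleton.elim _ _)⟩
  exact Real.iInf_of_isEmpty _

/-- Among finitely many sites the nearest-neighbour distance is attained. [folklore] -/
theorem exists_nearestDist_eq_dist [Finite ι] (y : ι → X) {j : ι} (hj : ∃ k, k ≠ j) :
    ∃ k, k ≠ j ∧ nearestDist y j = dist (y j) (y k) := by
  obtain ⟨k, hk⟩ := hj
  haveI : Nonempty {k : ι // k ≠ j} := ⟨⟨k, hk⟩⟩
  obtain ⟨k₀, hk₀⟩ :=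
    exists_eq_ciInf_of_finite (f := fun k : {k : ι // k ≠ j} => dist (y j) (y k.1))
  exact ⟨k₀.1, k₀.2, hk₀.symm⟩

/-- `nearestDist` is Mathlib's `Metric.infDist` from `y j` to the set of the other sites.
[folklore] -/
theorem nearestDist_eq_infDist (y : ι → X) (j : ι) :
    nearestDist y j = Metric.infDist (y j) (y '' {k | k ≠ j}) := by
  have hs : Function.Surjective (Set.imageFactorization y {k | k ≠ j}) :=
    Set.imageFactorization_surjective
  rw [Metric.infDist_eq_iInf, nearestDist_def, ← hs.iInf_comp]
  rfl

/-- **Similarities scale the nearest-neighbour distance**: if `dist (g p) (g q) = r · dist p q`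
(`r ≥ 0`), then `nn_j (g ∘ y) = r · nn_j (y)`. [folklore] -/
theorem nearestDist_comp_eq_mul_of_dist_eq {g : X → X'} {r : ℝ} (hr : 0 ≤ r)
    (hg : ∀ p q, dist (g p) (g q) = r * dist p q) (y : ι → X) (j : ι) :
    nearestDist (g ∘ y) j = r * nearestDist y j := by
  simp only [nearestDist, Function.comp_apply, hg]
  exact (Real.mul_iInf_of_nonneg hr _).symm

/-- Isometries preserve the nearest-neighbour distance. [folklore] -/
theorem nearestDist_comp_isometry {g : X → X'} (hg : Isometry g) (y : ι → X) (j : ι) :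
    nearestDist (g ∘ y) j = nearestDist y j := by
  rw [nearestDist_comp_eq_mul_of_dist_eq zero_le_one (fun p q => by rw [hg.dist_eq, one_mul]) y j,
    one_mul]

/-- Scaling a configuration in a normed space scales the nearest-neighbour distance:
`nn_j (c • y) = ‖c‖ · nn_j (y)`. [folklore] -/
theorem nearestDist_smul {𝕜 E : Type*} [NormedDivisionRing 𝕜] [SeminormedAddCommGroup E]
    [Module 𝕜 E] [NormSMulClass 𝕜 E] (c : 𝕜) (y : ι → E) (j : ι) :
    nearestDist (c • y) j = ‖c‖ * nearestDist y j :=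
  nearestDist_comp_eq_mul_of_dist_eq (g := fun p : E => c • p) (norm_nonneg c)
    (fun p q => dist_smul₀ c p q) y j

/-- Re-indexing the sites by an equivalence. [folklore] -/
theorem nearestDist_comp_equiv (y : ι → X) (e : κ ≃ ι) (j : κ) :
    nearestDist (y ∘ e) j = nearestDist y (e j) := by
  unfold nearestDist
  exact Equiv.iInf_congr (e.subtypeEquiv fun k => e.apply_eq_iff_eq.symm.not) fun _ => rfl

/-! ### The scale-free bond graph -/

/-- The **scale-free bond graph** of the configuration `y : ι → X` at tolerance `η`: two distinct
sites `j, k` are bonded iff `dist (y j) (y k) ≤ (1 + η) · min (nn_j) (nn_k)`, i.e. iff each lies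
within `1 + η` times the OTHER's (and its own) nearest-neighbour distance.  A soft, scale-free
version of the contact graph / bond graph with absolute bond range (Flatley–Theil's edge set `S`
and `CG(Z)`, De Luca–Friesecke's `(X, E)`); `SimpleGraph.fromRel` of the (symmetric) relation,
exactly as inlined in route LinkCensus. [folklore] -/
def bondGraph (η : ℝ) (y : ι → X) : SimpleGraph ι :=
  SimpleGraph.fromRel fun j k => dist (y j) (y k) ≤ (1 + η) * min (nearestDist y j) (nearestDist y k)

/-- Adjacency in the bond graph. [folklore] -/
theorem bondGraph_adj {η : ℝ} {y : ι → X} {j k : ι} :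
    (bondGraph η y).Adj j k ↔
      j ≠ k ∧ dist (y j) (y k) ≤ (1 + η) * min (nearestDist y j) (nearestDist y k) := by
  rw [bondGraph, SimpleGraph.fromRel_adj, dist_comm (y k), min_comm (nearestDist y k), or_self]

/-- Membership in a neighbour set of the bond graph. [folklore] -/
theorem mem_neighborSet_bondGraph {η : ℝ} {y : ι → X} {j k : ι} :
    k ∈ (bondGraph η y).neighborSet j ↔
      j ≠ k ∧ dist (y j) (y k) ≤ (1 + η) * min (nearestDist y j) (nearestDist y k) := by
  rw [SimpleGraph.mem_neighborSet, bondGraph_adj]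

/-- A bond at `j` is no longer than `(1 + η) · nn_j` (for `η ≥ −1`). [folklore] -/
theorem dist_le_of_adj {η : ℝ} (hη : 0 ≤ 1 + η) {y : ι → X} {j k : ι}
    (h : (bondGraph η y).Adj j k) : dist (y j) (y k) ≤ (1 + η) * nearestDist y j :=
  (bondGraph_adj.1 h).2.trans (mul_le_mul_of_nonneg_left (min_le_left _ _) hη)

/-- **Bonded sites have comparable scales**: `nn_j ≤ (1 + η) · nn_k` whenever `j ∼ k`
(for `η ≥ −1`). [folklore] -/
theorem nearestDist_le_mul_of_adj {η : ℝ} (hη : 0 ≤ 1 + η) {y : ι → X} {j k : ι}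
    (h : (bondGraph η y).Adj j k) : nearestDist y j ≤ (1 + η) * nearestDist y k := by
  obtain ⟨hne, hle⟩ := bondGraph_adj.1 h
  exact (nearestDist_le_dist y hne.symm).trans
    (hle.trans (mul_le_mul_of_nonneg_left (min_le_right _ _) hη))

/-- The bond graph is monotone in the tolerance. [folklore] -/
theorem bondGraph_mono {η η' : ℝ} (hη : η ≤ η') (y : ι → X) : bondGraph η y ≤ bondGraph η' y := by
  intro j k h
  obtain ⟨hne, hle⟩ := bondGraph_adj.1 h
  refine bondGraph_adj.2 ⟨hne, hle.trans ?_⟩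
  exact mul_le_mul_of_nonneg_right (by linarith)
    (le_min (nearestDist_nonneg y j) (nearestDist_nonneg y k))

/-- **Similarity invariance of the bond graph**: if `dist (g p) (g q) = r · dist p q` with `r > 0`
(a similarity onto its image), then `g ∘ y` and `y` have the same bond graph. [folklore] -/
theorem bondGraph_comp_eq_of_dist_eq {g : X → X'} {r : ℝ} (hr : 0 < r)
    (hg : ∀ p q, dist (g p) (g q) = r * dist p q) (η : ℝ) (y : ι → X) :
    bondGraph η (g ∘ y) = bondGraph η y := by
  ext j k
  simp only [bondGraph_adj, Function.comp_apply, hg, nearestDist_comp_eq_mul_of_dist_eq hr.le hg,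
    ← mul_min_of_nonneg _ _ hr.le]
  rw [mul_left_comm, mul_le_mul_iff_right₀ hr]

/-- Isometries preserve the bond graph. [folklore] -/
theorem bondGraph_comp_isometry {g : X → X'} (hg : Isometry g) (η : ℝ) (y : ι → X) :
    bondGraph η (g ∘ y) = bondGraph η y :=
  bondGraph_comp_eq_of_dist_eq one_pos (fun p q => by rw [hg.dist_eq, one_mul]) η y

/-- Scalings `y ↦ c • y` (`c ≠ 0`) of a configuration in a normed space preserve the bond graph.
[folklore] -/
theorem bondGraph_smul {𝕜 E : Type*} [NormedDivisionRing 𝕜] [SeminormedAddCommGroup E]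
    [Module 𝕜 E] [NormSMulClass 𝕜 E] {c : 𝕜} (hc : c ≠ 0) (η : ℝ) (y : ι → E) :
    bondGraph η (c • y) = bondGraph η y :=
  bondGraph_comp_eq_of_dist_eq (g := fun p : E => c • p) (norm_pos_iff.2 hc)
    (fun p q => dist_smul₀ c p q) η y

/-- Re-indexing the sites by an equivalence pulls the bond graph back. [folklore] -/
theorem bondGraph_comp_equiv (η : ℝ) (y : ι → X) (e : κ ≃ ι) :
    bondGraph η (y ∘ e) = (bondGraph η y).comap e := by
  ext j k
  simp only [bondGraph_adj, SimpleGraph.comap_adj, Function.comp_apply, nearestDist_comp_equiv,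
    ne_eq, e.apply_eq_iff_eq]

/-! ### Ring numbers -/

/-- The **ring number** of the pair `(i, j)`: the number of common bond-neighbours of `i` and `j`
(`Set.ncard` of `N(i) ∩ N(j)`; `0` if infinite).  For a bond `{i, j}` it is the number of cells of
the ring around the bond, i.e. the degree of `j` in the link of `i`; `4` for every bond of the fcc
and hcp close packings, `5` along icosahedral spines (Honeycutt–Andersen's common-neighbour
count; the quantity of Flatley–Theil's Conjecture 2.2). [folklore] -/
def ringNumber (η : ℝ) (y : ι → X) (i j : ι) : ℕ :=
  ((bondGraph η y).neighborSet i ∩ (bondGraph η y).neighborSet j).ncard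

/-- Unfolding `ringNumber`. [folklore] -/
theorem ringNumber_def (η : ℝ) (y : ι → X) (i j : ι) :
    ringNumber η y i j = ((bondGraph η y).neighborSet i ∩ (bondGraph η y).neighborSet j).ncard :=
  rfl

/-- The ring number counts Mathlib's `SimpleGraph.commonNeighbors`. [folklore] -/
theorem ringNumber_eq_ncard_commonNeighbors (η : ℝ) (y : ι → X) (i j : ι) :
    ringNumber η y i j = ((bondGraph η y).commonNeighbors i j).ncard := rfl

/-- The ring number is symmetric. [folklore] -/
theorem ringNumber_comm (η : ℝ) (y : ι → X) (i j : ι) : ringNumber η y i j = ringNumber η y j i := by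
  rw [ringNumber, ringNumber, Set.inter_comm]

/-- The ring number depends on the configuration only through its bond graph. [folklore] -/
theorem ringNumber_congr {η η' : ℝ} {y : ι → X} {y' : ι → X'}
    (h : bondGraph η y = bondGraph η' y') : ringNumber η y = ringNumber η' y' := by
  funext i j
  rw [ringNumber, ringNumber, h]

/-! ### Charge-free sites and the link charge -/

/-- The site `i` is **charge-free** at tolerance `η`: it has exactly `12` bonds in the scale-free
bond graph, and every bond `{i, j}` at `i` has ring number exactly `4` (the link of `i` is a
`4`-regular graph on `12` vertices, as the cuboctahedron `3.4.3.4` and the anticuboctahedron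
`3.3.4.4` are).  The scale-free ring form of Flatley–Theil's regular points
(`#N(x) = 12` and `½ #A(x) = 24` link edges, Definition 3.6) with their Conjecture 2.2
(`#(N ∩ N′) ≥ 4`, hence `= 4`) built in; requested by route LinkCensus, where it is inlined
(`isChargeFree_iff_route`). [folklore] -/
def IsChargeFree (η : ℝ) (y : ι → X) (i : ι) : Prop :=
  ((bondGraph η y).neighborSet i).ncard = 12 ∧
    ∀ j ∈ (bondGraph η y).neighborSet i, ringNumber η y i j = 4

/-- Unfolding `IsChargeFree`. [folklore] -/
theorem isChargeFree_iff {η : ℝ} {y : ι → X} {i : ι} :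
    IsChargeFree η y i ↔
      ((bondGraph η y).neighborSet i).ncard = 12 ∧
        ∀ j ∈ (bondGraph η y).neighborSet i, ringNumber η y i j = 4 :=
  Iff.rfl

/-- **The inlined form.**  `IsChargeFree η y i` is, definitionally, the `let`-expression inlined
in the items of route `AtomisticToContinuum/Crystallization/LinkCensus` (for `ι = Fin N`,
`X = EuclideanSpace ℝ (Fin 3)` this is literally the text of `ZeroChargeBulk`, `ChargedEnergyGap`,
`TruncatedCensusGap`, `SoftFourRings`, …), so those items can be restated over `IsChargeFree` by
`Iff.rfl`. [folklore] -/
theorem isChargeFree_iff_route (η : ℝ) (y : ι → X) (i : ι) :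
    IsChargeFree η y i ↔
      (let nn : ι → ℝ := fun j => ⨅ k : {k : ι // k ≠ j}, dist (y j) (y k.1)
      let G : SimpleGraph ι :=
        SimpleGraph.fromRel fun j k => dist (y j) (y k) ≤ (1 + η) * min (nn j) (nn k)
      (G.neighborSet i).ncard = 12 ∧
        ∀ j ∈ G.neighborSet i, (G.neighborSet i ∩ G.neighborSet j).ncard = 4) :=
  Iff.rfl

/-- The same, specialised to the route's types `Fin N → EuclideanSpace ℝ (Fin 3)`. [folklore] -/
theorem isChargeFree_iff_route_fin {N : ℕ} (η : ℝ) (y : Fin N → EuclideanSpace ℝ (Fin 3))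
    (i : Fin N) :
    IsChargeFree η y i ↔
      (let nn : Fin N → ℝ := fun j => ⨅ k : {k : Fin N // k ≠ j}, dist (y j) (y k.1)
      let G : SimpleGraph (Fin N) :=
        SimpleGraph.fromRel fun j k => dist (y j) (y k) ≤ (1 + η) * min (nn j) (nn k)
      (G.neighborSet i).ncard = 12 ∧
        ∀ j ∈ G.neighborSet i, (G.neighborSet i ∩ G.neighborSet j).ncard = 4) :=
  Iff.rfl

/-- A charge-free site has twelve bonds. [folklore] -/
theorem IsChargeFree.ncard_neighborSet {η : ℝ} {y : ι → X} {i : ι} (h : IsChargeFree η y i) :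
    ((bondGraph η y).neighborSet i).ncard = 12 := h.1

/-- Every bond at a charge-free site has ring number `4`. [folklore] -/
theorem IsChargeFree.ringNumber_eq {η : ℝ} {y : ι → X} {i j : ι} (h : IsChargeFree η y i)
    (hj : j ∈ (bondGraph η y).neighborSet i) : ringNumber η y i j = 4 := h.2 j hj

/-- The neighbour set of a charge-free site is finite (its `ncard` is `12 ≠ 0`). [folklore] -/
theorem IsChargeFree.finite_neighborSet {η : ℝ} {y : ι → X} {i : ι} (h : IsChargeFree η y i) :
    ((bondGraph η y).neighborSet i).Finite :=
  Set.finite_of_ncard_ne_zero (by rw [h.1]; decide)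

/-- Charge-freeness depends on the configuration only through its bond graph. [folklore] -/
theorem isChargeFree_congr {η η' : ℝ} {y : ι → X} {y' : ι → X'}
    (h : bondGraph η y = bondGraph η' y') (i : ι) : IsChargeFree η y i ↔ IsChargeFree η' y' i := by
  rw [isChargeFree_iff, isChargeFree_iff, ringNumber_congr h, h]

/-- **Similarity invariance**: `g ∘ y` and `y` have the same charge-free sites whenever
`dist (g p) (g q) = r · dist p q` with `r > 0`. [folklore] -/
theorem isChargeFree_comp_iff_of_dist_eq {g : X → X'} {r : ℝ} (hr : 0 < r)
    (hg : ∀ p q, dist (g p) (g q) = r * dist p q) (η : ℝ) (y : ι → X) (i : ι) :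
    IsChargeFree η (g ∘ y) i ↔ IsChargeFree η y i :=
  isChargeFree_congr (bondGraph_comp_eq_of_dist_eq hr hg η y) i

/-- Isometry invariance of charge-freeness. [folklore] -/
theorem isChargeFree_comp_isometry_iff {g : X → X'} (hg : Isometry g) (η : ℝ) (y : ι → X) (i : ι) :
    IsChargeFree η (g ∘ y) i ↔ IsChargeFree η y i :=
  isChargeFree_congr (bondGraph_comp_isometry hg η y) i

/-- Scale invariance of charge-freeness (`c ≠ 0`). [folklore] -/
theorem isChargeFree_smul_iff {𝕜 E : Type*} [NormedDivisionRing 𝕜] [SeminormedAddCommGroup E]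
    [Module 𝕜 E] [NormSMulClass 𝕜 E] {c : 𝕜} (hc : c ≠ 0) (η : ℝ) (y : ι → E) (i : ι) :
    IsChargeFree η (c • y) i ↔ IsChargeFree η y i :=
  isChargeFree_congr (bondGraph_smul hc η y) i

/-- Re-indexing invariance: site `i` of `y ∘ e` is charge-free iff site `e i` of `y` is.
[folklore] -/
theorem isChargeFree_comp_equiv_iff (η : ℝ) (y : ι → X) (e : κ ≃ ι) (i : κ) :
    IsChargeFree η (y ∘ e) i ↔ IsChargeFree η y (e i) := by
  have hN : ∀ j : κ,
      (bondGraph η (y ∘ e)).neighborSet j = e ⁻¹' (bondGraph η y).neighborSet (e j) := by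
    intro j
    ext k
    rw [SimpleGraph.mem_neighborSet, bondGraph_comp_equiv, SimpleGraph.comap_adj, Set.mem_preimage,
      SimpleGraph.mem_neighborSet]
  have hc : ∀ s : Set ι, (e ⁻¹' s).ncard = s.ncard := fun s =>
    Set.ncard_preimage_of_injective_subset_range e.injective (by simp [e.range_eq_univ])
  simp only [isChargeFree_iff, ringNumber_def, hN, ← Set.preimage_inter, hc, Set.mem_preimage]
  refine and_congr_right fun _ => ⟨fun H j hj => ?_, fun H j hj => H (e j) hj⟩
  simpa only [e.apply_symm_apply] using H (e.symm j) (by simpa only [e.apply_symm_apply] using hj)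

/-- The **link charge** of the site `i`: `|#N(i) − 12| + Σ_{j ∈ N(i)} |ringNumber i j − 4|`, a
natural number vanishing exactly at charge-free sites (`linkCharge_eq_zero_iff`) — the integer
defect charge of route LinkCensus (reference link: `12` neighbours, all rings `4`; Nelson's
disclination charge for tetrahedrally close-packed order uses reference ring number `5`).
The sum is a `finsum` (`0` if the neighbour set is infinite). [folklore] -/
def linkCharge (η : ℝ) (y : ι → X) (i : ι) : ℕ :=
  Int.natAbs ((((bondGraph η y).neighborSet i).ncard : ℤ) - 12) +
    ∑ᶠ j ∈ (bondGraph η y).neighborSet i, Int.natAbs ((ringNumber η y i j : ℤ) - 4)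

/-- Unfolding `linkCharge`. [folklore] -/
theorem linkCharge_def (η : ℝ) (y : ι → X) (i : ι) :
    linkCharge η y i =
      Int.natAbs ((((bondGraph η y).neighborSet i).ncard : ℤ) - 12) +
        ∑ᶠ j ∈ (bondGraph η y).neighborSet i, Int.natAbs ((ringNumber η y i j : ℤ) - 4) :=
  rfl

/-- **Zero charge = charge-free.** [folklore] -/
theorem linkCharge_eq_zero_iff {η : ℝ} {y : ι → X} {i : ι} :
    linkCharge η y i = 0 ↔ IsChargeFree η y i := by
  have key12 : ∀ n : ℕ, Int.natAbs ((n : ℤ) - 12) = 0 ↔ n = 12 := fun n => by omega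
  have key4 : ∀ n : ℕ, Int.natAbs ((n : ℤ) - 4) = 0 ↔ n = 4 := fun n => by omega
  rw [linkCharge_def, Nat.add_eq_zero_iff, isChargeFree_iff, key12]
  refine and_congr_right fun h12 => ?_
  have hfin : ((bondGraph η y).neighborSet i).Finite :=
    Set.finite_of_ncard_ne_zero (by rw [h12]; decide)
  rw [finsum_mem_eq_finite_toFinset_sum _ hfin, Finset.sum_eq_zero_iff]
  simp only [Set.Finite.mem_toFinset, key4]

/-- The link charge depends on the configuration only through its bond graph (hence it is
invariant under similarities, isometries and scalings, by `bondGraph_comp_eq_of_dist_eq`,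
`bondGraph_comp_isometry`, `bondGraph_smul`). [folklore] -/
theorem linkCharge_congr {η η' : ℝ} {y : ι → X} {y' : ι → X'}
    (h : bondGraph η y = bondGraph η' y') : linkCharge η y = linkCharge η' y' := by
  funext i
  rw [linkCharge_def, linkCharge_def, ringNumber_congr h, h]

end Literature.Geometry.DiscreteGeometry

end
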